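import Literature.MathematicalPhysics.QuantumLattice.PairCorrelations
import HarnessLib

/-!
# Pair correlations: the `d`-wave pair wavefunction is `B₁g`-symmetric (proofs)

Trunk T-QLATTICE, family `hubbard` (companion of
`Literature.MathematicalPhysics.QuantumLattice.PairCorrelations`, which defines the site action
`d4Site`/`d4Orb`/`d4Act` of `D₄ = DihedralGroup 4` on the fermionic torus, the `B₁g` character
`b1gChar`, the predicate `IsDWaveSymmetric`, the pair wavefunction `pairFieldWavefunction` and
states the named facts `isDWaveSymmetric_pairFieldWavefunction_dWave`, `dWaveFormFactor_rotate`;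
this file only PROVES — it declares no definition).

## Contents

* additivity and injectivity of `rotSite`, `reflSite` on `(ℤ/Lℤ)²` (`rotSite_add`,
  `reflSite_add`, `rotSite_injective`, `reflSite_injective`), and the intertwining of the
  one-step maps `e ↦ ![-e 1, e 0]`, `e ↦ ![e 0, -e 1]` of `ℤ²` with them under `Torus.proj`
  (`Torus.proj_rotate`, `Torus.proj_reflect`);
* these one-step maps permute the step set `{0} ∪ unitSteps = {0, ±e₁, ±e₂}`, so step sums may
  be reindexed (`sum_steps_rotate`, `sum_steps_reflect`);
* the discharge **`dWaveFormFactor_rotate_holds`** of `dWaveFormFactor_rotate`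
  (`g_d (-b, a) = -g_d (a, b)`) and evenness under the reflection (`dWaveFormFactor_reflect`);
  `χ_{B₁g}(γ⁻¹) = χ_{B₁g}(γ)` (`b1gChar_inv`);
* the covariance of the step sums `Σ_{e} [y' = x' + π e] A (g_d e)` when `(x', y')` is
  `(rot x, rot y)` (sign `-1`, `sum_steps_dWave_rotSite`; iterated, `(-1)ⁿ`,
  `sum_steps_dWave_rotSite_iterate`), `(refl x, refl y)` (sign `+1`, `sum_steps_dWave_reflSite`)
  and `(d4Site γ x, d4Site γ y)` (factor `χ_{B₁g}(γ)`, `sum_steps_dWave_d4Site`), for any odd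
  amplitude `A : ℝ → ℂ`;
* `φ_d (γ o₁, γ o₂) = χ_{B₁g}(γ) φ_d (o₁, o₂)` (`pairFieldWavefunction_dWave_d4Orb`) and the
  discharge **`isDWaveSymmetric_pairFieldWavefunction_dWave_holds`** of the named fact
  `isDWaveSymmetric_pairFieldWavefunction_dWave`: `γ • φ_d = χ_{B₁g}(γ) φ_d` for all
  `γ : DihedralGroup 4` and every side `L ≥ 1` (so `IsDWaveSymmetric` is not vacuous).

## Proof sketch

`φ_d (o₁, o₂) = Σ_{e ∈ {0} ∪ unitSteps} [x₂ = x₁ + π_L e] A_{σ₁σ₂}(g_d e)` with an amplitude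
`A_{σ₁σ₂}` that is odd (indeed `ℝ`-linear) in `g_d e`. Replacing `(x₁, x₂)` by
`(γ x₁, γ x₂)` and reindexing the steps by the corresponding map `γ̂` of `ℤ²` (a permutation of
`{0} ∪ unitSteps`), the indicator becomes `[γ x₂ = γ x₁ + π_L (γ̂ e)] = [γ x₂ = γ (x₁ + π_L e)]
= [x₂ = x₁ + π_L e]` (additivity, intertwining, injectivity), while `g_d (γ̂ e) = χ_{B₁g}(γ) g_d e`
(`g_d ∘ rot = -g_d`, `g_d ∘ refl = g_d`, and `χ_{B₁g}(r i) = χ_{B₁g}(sr i) = (-1)^i`). The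
iterates `rotSite^[i.val]` inside `d4Site` are handled by induction on the exponent, so no
`ℤ²`-action of `D₄` needs to be defined. Finally `d4Act γ` evaluates `φ_d` at `γ⁻¹`-moved
orbitals and `χ_{B₁g}(γ⁻¹) = χ_{B₁g}(γ)`. The identity holds for every `L ≥ 1` (for `L ≤ 2`
coincident torus steps are summed on both sides alike).

## Sources

D. J. Scalapino, *The case for d_{x²-y²} pairing in the cuprate superconductors*, Phys. Rep. 250
(1995) 329, §2, eq. (2.2)–(2.3) (the `d_{x²-y²}` pair field with form factor `+1` on `x`-bonds,
`-1` on `y`-bonds; the gap `Δ_k ∝ cos kₓ - cos k_y` belongs to the `B₁g` representation of the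
square-lattice point group `C₄ᵥ ≅ D₄`); T. Xiang, C. Wu, *D-wave Superconductivity* (CUP 2022),
§1.14–§1.15 (the `d`-wave gap function changes sign under a rotation by `90°` about the `c`-axis)
and §11.2 (`B₁g` carries the `d_{x²-y²}` symmetry). The sources fix the conventions; the
covariance itself is an elementary computation with the definitions of `PairCorrelations`.

## Design notes

* No definition is introduced: the one-step maps of `ℤ²` appear as the explicit terms
  `![-e 1, e 0]`, `![e 0, -e 1]`; the spin-dependent amplitude of `pairFieldWavefunction` enters
  the step-sum lemmas as an arbitrary odd function `A : ℝ → ℂ`, instantiated by `exact` (the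
  summand of `pairFieldWavefunction` is `A (dWaveFormFactor e)` up to `β`-reduction).
* All torus lemmas hold for every side `L : ℕ`; `NeZero L` is needed only where orbitals are
  moved (`d4Orb`, through `FermionTorus.ofTorusSite`).
-/

noncomputable section

namespace Literature.MathematicalPhysics.QuantumLattice

open Matrix Finset Filter Literature.Probability.LatticeModels
open scoped ComplexOrder

section DWaveSymmetry

/-- The rotation `rotSite` of the torus is additive. Scalapino, Phys. Rep. 250 (1995) 329, §2. [folklore] -/
theorem rotSite_add {L : ℕ} (x y : TorusSite 2 L) : rotSite (x + y) = rotSite x + rotSite y := by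
  funext i; fin_cases i <;> simp [rotSite, add_comm]

/-- The reflection `reflSite` of the torus is additive. Scalapino, Phys. Rep. 250 (1995) 329, §2. [folklore] -/
theorem reflSite_add {L : ℕ} (x y : TorusSite 2 L) : reflSite (x + y) = reflSite x + reflSite y := by
  funext i; fin_cases i <;> simp [reflSite, add_comm]

/-- `rotSite` is injective. Scalapino, Phys. Rep. 250 (1995) 329, §2. [folklore] -/
theorem rotSite_injective {L : ℕ} : Function.Injective (rotSite (L := L)) := by
  intro x y h
  have h0 := congrFun h 0
  have h1 := congrFun h 1
  simp only [rotSite, Matrix.cons_val_zero, Matrix.cons_val_one, neg_inj] at h0 h1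
  funext i; fin_cases i <;> assumption

/-- `reflSite` is injective. Scalapino, Phys. Rep. 250 (1995) 329, §2. [folklore] -/
theorem reflSite_injective {L : ℕ} : Function.Injective (reflSite (L := L)) := by
  intro x y h
  have h0 := congrFun h 0
  have h1 := congrFun h 1
  simp only [reflSite, Matrix.cons_val_zero, Matrix.cons_val_one, neg_inj] at h0 h1
  funext i; fin_cases i <;> assumption

/-- `Torus.proj` intertwines the rotation `(a, b) ↦ (-b, a)` of `ℤ²` with `rotSite`.
Friedli–Velenik (2017), §3.1; Scalapino, Phys. Rep. 250 (1995) 329, §2. [folklore] -/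
theorem Torus.proj_rotate (L : ℕ) (e : Site 2) :
    Torus.proj (d := 2) L ![-e 1, e 0] = rotSite (Torus.proj L e) := by
  funext i; fin_cases i <;> simp [rotSite]

/-- `Torus.proj` intertwines the reflection `(a, b) ↦ (a, -b)` of `ℤ²` with `reflSite`.
Friedli–Velenik (2017), §3.1; Scalapino, Phys. Rep. 250 (1995) 329, §2. [folklore] -/
theorem Torus.proj_reflect (L : ℕ) (e : Site 2) :
    Torus.proj (d := 2) L ![e 0, -e 1] = reflSite (Torus.proj L e) := by
  funext i; fin_cases i <;> simp [reflSite]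

/-- The rotation `(a, b) ↦ (-b, a)` of `ℤ²` permutes the step set `{0, ±e₁, ±e₂}`, so sums over
it may be reindexed. Scalapino, Phys. Rep. 250 (1995) 329, §2. [folklore] -/
theorem sum_steps_rotate {M : Type*} [AddCommMonoid M] (F : Site 2 → M) :
    ∑ e ∈ insert (0 : Site 2) unitSteps, F ![-e 1, e 0] =
      ∑ e ∈ insert (0 : Site 2) unitSteps, F e := by
  refine Finset.sum_nbij' (fun e : Site 2 => (![-e 1, e 0] : Site 2))
    (fun e : Site 2 => (![e 1, -e 0] : Site 2)) ?_ ?_ ?_ ?_ fun _ _ => rfl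
  · intro e he
    simp only [unitSteps, Finset.mem_insert, Finset.mem_singleton] at he ⊢
    rcases he with rfl | rfl | rfl | rfl | rfl <;> decide
  · intro e he
    simp only [unitSteps, Finset.mem_insert, Finset.mem_singleton] at he ⊢
    rcases he with rfl | rfl | rfl | rfl | rfl <;> decide
  · intro e _
    funext i; fin_cases i <;> simp
  · intro e _
    funext i; fin_cases i <;> simp

/-- The reflection `(a, b) ↦ (a, -b)` of `ℤ²` permutes the step set `{0, ±e₁, ±e₂}` (it is an
involution preserving it). Scalapino, Phys. Rep. 250 (1995) 329, §2. [folklore] -/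
theorem sum_steps_reflect {M : Type*} [AddCommMonoid M] (F : Site 2 → M) :
    ∑ e ∈ insert (0 : Site 2) unitSteps, F ![e 0, -e 1] =
      ∑ e ∈ insert (0 : Site 2) unitSteps, F e := by
  refine Finset.sum_nbij' (fun e : Site 2 => (![e 0, -e 1] : Site 2))
    (fun e : Site 2 => (![e 0, -e 1] : Site 2)) ?_ ?_ ?_ ?_ fun _ _ => rfl
  · intro e he
    simp only [unitSteps, Finset.mem_insert, Finset.mem_singleton] at he ⊢
    rcases he with rfl | rfl | rfl | rfl | rfl <;> decide
  · intro e he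
    simp only [unitSteps, Finset.mem_insert, Finset.mem_singleton] at he ⊢
    rcases he with rfl | rfl | rfl | rfl | rfl <;> decide
  · intro e _
    funext i; fin_cases i <;> simp
  · intro e _
    funext i; fin_cases i <;> simp

/-- Discharge of the named fact `dWaveFormFactor_rotate`: the `d_{x²-y²}` form factor is odd under
the rotation by `π/2`. Scalapino, Phys. Rep. 250 (1995) 329, §2, eq. (2.3). [cite: Scalapino1995, §2] -/
theorem dWaveFormFactor_rotate_holds : dWaveFormFactor_rotate := by
  intro e
  simp only [dWaveFormFactor, funext_iff, Fin.forall_fin_two, Matrix.cons_val_zero,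
    Matrix.cons_val_one, Pi.single_apply, Pi.neg_apply]
  split_ifs <;> norm_num <;> omega

/-- The `d_{x²-y²}` form factor is even under the reflection `(a, b) ↦ (a, -b)`.
Scalapino, Phys. Rep. 250 (1995) 329, §2, eq. (2.3). [folklore] -/
theorem dWaveFormFactor_reflect (e : Site 2) : dWaveFormFactor ![e 0, -e 1] = dWaveFormFactor e := by
  simp only [dWaveFormFactor, funext_iff, Fin.forall_fin_two, Matrix.cons_val_zero,
    Matrix.cons_val_one, Pi.single_apply, Pi.neg_apply]
  split_ifs <;> norm_num <;> omega

/-- `χ_{B₁g}` is inversion invariant (it is real-valued, `±1`).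
Scalapino, Phys. Rep. 250 (1995) 329, §2. [folklore] -/
theorem b1gChar_inv (γ : DihedralGroup 4) : b1gChar γ⁻¹ = b1gChar γ := by
  cases γ with
  | r i =>
    simp only [DihedralGroup.inv_r, b1gChar]
    have h : ∀ j : ZMod 4, (-j).val % 2 = j.val % 2 := by decide
    rw [neg_one_pow_eq_pow_mod_two, h i, ← neg_one_pow_eq_pow_mod_two]
  | sr i => simp only [DihedralGroup.inv_sr]

variable {L : ℕ}

/-- One rotation step of the covariance computation: for an odd amplitude `A`, the step sum
`Σ_{e} [rot y = rot x + π e] A (g_d e)` equals `-Σ_{e} [y = x + π e] A (g_d e)` (reindex the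
steps by the rotation of `ℤ²`, use additivity and injectivity of `rotSite` and
`dWaveFormFactor_rotate`). Scalapino, Phys. Rep. 250 (1995) 329, §2. [folklore] -/
theorem sum_steps_dWave_rotSite (x y : TorusSite 2 L) (A : ℝ → ℂ) (hA : ∀ t, A (-t) = -A t) :
    ∑ e ∈ insert (0 : Site 2) unitSteps,
        (if rotSite y = rotSite x + Torus.proj L e then A (dWaveFormFactor e) else 0) =
      -∑ e ∈ insert (0 : Site 2) unitSteps,
        (if y = x + Torus.proj L e then A (dWaveFormFactor e) else 0) := by
  rw [← sum_steps_rotate (fun e => if rotSite y = rotSite x + Torus.proj L e then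
    A (dWaveFormFactor e) else 0), ← Finset.sum_neg_distrib]
  refine Finset.sum_congr rfl fun e _ => ?_
  simp only [Torus.proj_rotate, ← rotSite_add, rotSite_injective.eq_iff,
    dWaveFormFactor_rotate_holds e, hA, neg_ite, neg_zero]

/-- Iterated rotations: `Σ_{e} [rotⁿ y = rotⁿ x + π e] A (g_d e) = (-1)ⁿ Σ_{e} [y = x + π e] A (g_d e)`.
Scalapino, Phys. Rep. 250 (1995) 329, §2. [folklore] -/
theorem sum_steps_dWave_rotSite_iterate (n : ℕ) (x y : TorusSite 2 L) (A : ℝ → ℂ)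
    (hA : ∀ t, A (-t) = -A t) :
    ∑ e ∈ insert (0 : Site 2) unitSteps,
        (if rotSite^[n] y = rotSite^[n] x + Torus.proj L e then A (dWaveFormFactor e) else 0) =
      (-1) ^ n * ∑ e ∈ insert (0 : Site 2) unitSteps,
        (if y = x + Torus.proj L e then A (dWaveFormFactor e) else 0) := by
  induction n generalizing x y with
  | zero => rw [pow_zero, one_mul]; rfl
  | succ n ih =>
    rw [Function.iterate_succ_apply, Function.iterate_succ_apply, ih, sum_steps_dWave_rotSite x y A hA,
      pow_succ]
    ring

/-- One reflection: `Σ_{e} [refl y = refl x + π e] A (g_d e) = Σ_{e} [y = x + π e] A (g_d e)`.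
Scalapino, Phys. Rep. 250 (1995) 329, §2. [folklore] -/
theorem sum_steps_dWave_reflSite (x y : TorusSite 2 L) (A : ℝ → ℂ) :
    ∑ e ∈ insert (0 : Site 2) unitSteps,
        (if reflSite y = reflSite x + Torus.proj L e then A (dWaveFormFactor e) else 0) =
      ∑ e ∈ insert (0 : Site 2) unitSteps,
        (if y = x + Torus.proj L e then A (dWaveFormFactor e) else 0) := by
  rw [← sum_steps_reflect (fun e => if reflSite y = reflSite x + Torus.proj L e then
    A (dWaveFormFactor e) else 0)]
  refine Finset.sum_congr rfl fun e _ => ?_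
  simp only [Torus.proj_reflect, ← reflSite_add, reflSite_injective.eq_iff, dWaveFormFactor_reflect]

/-- The step sums transform under `d4Site γ` with the character `χ_{B₁g}(γ)`.
Scalapino, Phys. Rep. 250 (1995) 329, §2. [folklore] -/
theorem sum_steps_dWave_d4Site (γ : DihedralGroup 4) (x y : TorusSite 2 L) (A : ℝ → ℂ)
    (hA : ∀ t, A (-t) = -A t) :
    ∑ e ∈ insert (0 : Site 2) unitSteps,
        (if d4Site γ y = d4Site γ x + Torus.proj L e then A (dWaveFormFactor e) else 0) =
      b1gChar γ * ∑ e ∈ insert (0 : Site 2) unitSteps,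
        (if y = x + Torus.proj L e then A (dWaveFormFactor e) else 0) := by
  cases γ with
  | r i => exact sum_steps_dWave_rotSite_iterate i.val x y A hA
  | sr i =>
    show ∑ e ∈ insert (0 : Site 2) unitSteps,
        (if reflSite (rotSite^[i.val] y) = reflSite (rotSite^[i.val] x) + Torus.proj L e then
          A (dWaveFormFactor e) else 0) = (-1) ^ i.val * _
    rw [sum_steps_dWave_reflSite, sum_steps_dWave_rotSite_iterate i.val x y A hA]

/-- The `d`-wave pair wavefunction is `B₁g`-covariant under the site action of `D₄`:
`φ_d (γ o₁, γ o₂) = χ_{B₁g}(γ) φ_d (o₁, o₂)`. Scalapino, Phys. Rep. 250 (1995) 329, §2. [folklore] -/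
theorem pairFieldWavefunction_dWave_d4Orb (L : ℕ) [NeZero L] (γ : DihedralGroup 4)
    (p : Orb (FermionTorus 2 L) × Orb (FermionTorus 2 L)) :
    pairFieldWavefunction dWaveFormFactor L (d4Orb γ p.1, d4Orb γ p.2) =
      b1gChar γ * pairFieldWavefunction dWaveFormFactor L p := by
  simp only [pairFieldWavefunction, d4Orb, ofLex_toLex, FermionTorus.toTorusSite_ofTorusSite]
  exact sum_steps_dWave_d4Site γ _ _
    (fun t => if (ofLex p.1).2 = 0 ∧ (ofLex p.2).2 = 1 then -((t / Real.sqrt 2 : ℝ) : ℂ)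
      else if (ofLex p.1).2 = 1 ∧ (ofLex p.2).2 = 0 then ((t / Real.sqrt 2 : ℝ) : ℂ) else 0)
    (fun t => by split_ifs <;> push_cast <;> ring)

/-- **Discharge of the named fact `isDWaveSymmetric_pairFieldWavefunction_dWave`**: the `d`-wave
pair wavefunction `φ_d` transforms in the `B₁g` (`x² - y²`) representation of `D₄`,
`γ • φ_d = χ_{B₁g}(γ) φ_d` (so `IsDWaveSymmetric` is not vacuous). Proof: `D₄` acts on
`(ℤ/Lℤ)²` additively and injectively, `Torus.proj` intertwines it with the action on `ℤ²`, which
permutes `{0} ∪ unitSteps`, and `g_d ∘ rot = -g_d`, `g_d ∘ refl = g_d`; finally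
`χ_{B₁g}(γ⁻¹) = χ_{B₁g}(γ)`. Scalapino, Phys. Rep. 250 (1995) 329, §2 (the `d_{x²-y²}` gap
`Δ_k ∝ cos kₓ - cos k_y` belongs to `B₁g` of the square-lattice point group); see also
Xiang–Wu, *d-wave Superconductivity* (CUP 2022), §1.5. [cite: Scalapino1995, §2] -/
theorem isDWaveSymmetric_pairFieldWavefunction_dWave_holds (L : ℕ) [NeZero L] :
    isDWaveSymmetric_pairFieldWavefunction_dWave L := by
  intro γ
  funext p
  simp only [d4Act, Pi.smul_apply, smul_eq_mul]
  rw [pairFieldWavefunction_dWave_d4Orb, b1gChar_inv]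

end DWaveSymmetry

end Literature.MathematicalPhysics.QuantumLattice
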